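import Summits.BirchSwinnertonDyer.BirchSwinnertonDyer.Theorems.ByReductionTypeAtTwoAdditiveReducibleKatoMemberSharp
import Summits.BirchSwinnertonDyer.BirchSwinnertonDyer.Theorems.ByReductionTypeAtTwoAdditiveReducibleKatoMemberNST
import Literature.NumberTheory.EllipticCurves.Kato2004.MemberHullInputsTwoNoSplitTwistSharp
import HarnessLib

/-!
# Crux `AdditiveRankZeroAtTwo` (K4 item 19098), `E[2]`-REDUCIBLE curves ADDITIVE at `2` under (NST′) «no split multiplicative
# twist by `−1` or `−2` at `2`» (potentially good OR potentially multiplicative): the UPPER half at `2` with NO side condition,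
# from the (NST′) member package with the SHARP count (`Kato2004.exists_memberHullInputs_two_sharp_of_noSplitTwistNegOneNegTwo`)

Seat `bsd-2adic-k4-w2` GEN 4 (prover, cell `bsd-2adic`, rung K4). `--supports` helper (children C2″ 22616 / C4″ 22618 of 19098:
the file covers C2″'s whole block again and removes the side conditions «no point of order `4`·(odd) in the class ∧ `ord₂ #Ш_an`
even» from the (NST′) potentially multiplicative reducible door `missingUpperBoundAt_two_of_katoMember_two_NST` of addL2x GEN 13,
so that child C4″ `AdditivePotMultOverKAtTwo` is load-bearing for the UPPER half only on the reducible potentially multiplicative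
curves WITH a split multiplicative twist by `−1` or `−2`). Closes nothing (conditional on named facts). HONEST FRAMING: BSD is not
proved by any of this. The mathematics is R12♯ of `Kato2004/MemberHullInputsTwoSharp.lean` (the count of the member package is
`2t`: `#H¹_F(ℚ,T) · #(S₂(E/ℚ)/H¹_F(ℚ,T)) = 2^t`), which is reduction-type-free among additive curves (R13 of
`Kato2004/MemberHullInputsTwoNoSplitTwist.lean`); the proofs are those of `…AdditiveReducibleKatoMemberSharp.lean` with
`hj : 0 ≤ ord₂ j` replaced by (NST′) (fed to the fact only).

* §0 `exists_memberHullInputs_two_sharp_of_noSplitTwistSharp` / `exists_memberHullInputs_two_NST_of_noSplitTwistSharp` — the new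
  fact implies the potentially-good sharp fact (potentially good ⟹ (NST′)) and the audited (NST′) fact (pure logic).
* §1 `katoMemberShaBound_two_sharp_NST` — member bound with exponent `2t` under (NST′).
* §2 `missingUpperBoundAt_two_of_katoMemberSharp_two_NST` — `MissingUpperBoundAt W 2` for EVERY globally minimal non-CM `W`
  additive at `2` with (NST′), `W[2]` reducible, `r_an = 0`; no torsion/parity side condition (Cassels transport).
* §3 `addPotMultNST_reducibleUpper_two_sharp` — the block form keyed like the v8 residual's member branch
  (`¬CM → r_an = 0 → Addv W 2 → ord₂ j < 0 → (NST′) → ¬irreducible → MissingUpperBoundAt W 2`).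

References: [Kato2004Asterisque] Thm. 12.4–12.6, (12.5.1) (pp. 221–222), 13.13 (p. 233), Thm. 14.5 (p. 236), §14.8, §14.14,
Prop. 14.16 (2) and its proof (pp. 238–245); [MazurRubin2004] Thm. 2.3.4; [SilvermanATAEC1994] V.5.3; [Lim2017FineSelmer]
Thm. 3.5; [FerreroWashington1979]; [Cassels1965ArithmeticVIII]; [MilneADT2006] I.7.3; [Miller2011LMS] Def. 1.1. Memo
`run/shared/lean/pub/bsd-2adic/k4w2/gen4/READING-hMH2sharp-count-2t.md`.
-/

set_option autoImplicit false
set_option linter.dupNamespace false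

noncomputable section

open scoped Classical

namespace Summit.BirchSwinnertonDyer.BirchSwinnertonDyer.Theorems.AddKatoTwo

open WeierstrassCurve Literature.NumberTheory.EllipticCurves
  Literature.NumberTheory.EllipticCurves.ModularForms
  Literature.NumberTheory.EllipticCurves.Kato2004
  Literature.NumberTheory.EllipticCurves.IwasawaAlgebra
  Literature.NumberTheory.EllipticCurves.Rank1Residual
  Literature.NumberTheory.EllipticCurves.Rank1Residual.Typed
  Literature.NumberTheory.IwasawaTheory
  Summit.BirchSwinnertonDyer.Rank1Residual Summit.BirchSwinnertonDyer.Rank1Residual.Additive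
  Summit.BirchSwinnertonDyer.Rank1Residual.X5.AddTwoL2

/-! ## §0 The new fact implies the potentially-good sharp fact and the audited (NST′) fact -/

/-- **(NST′)-sharp ⟹ potentially-good-sharp**: a potentially good curve has no split multiplicative twist by `−1` or `−2`
(`noSplitTwistNegOneNegTwo_of_padicValRat_j_nonneg`), so `exists_memberHullInputs_two_sharp_of_noSplitTwistNegOneNegTwo`
implies `exists_memberHullInputs_two_sharp`. Pure logic. [cite: Kato2004Asterisque, Thm. 12.5 (3) and (12.5.1) (p. 222)] -/
theorem exists_memberHullInputs_two_sharp_of_noSplitTwistSharp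
    (h : Kato2004.exists_memberHullInputs_two_sharp_of_noSplitTwistNegOneNegTwo) :
    Kato2004.exists_memberHullInputs_two_sharp := by
  intro W _ _ hcm hng hnm hj hred hL hfin
  exact h W hcm hng hnm (noSplitTwistNegOneNegTwo_of_padicValRat_j_nonneg W hj) hred hL hfin

/-- **(NST′)-sharp ⟹ (NST′)** (the audited fact `exists_memberHullInputs_two_of_noSplitTwistNegOneNegTwo`): the package inhabits
the structure. Pure logic. [cite: Kato2004Asterisque, Prop. 14.16 (2) (p. 244)] -/
theorem exists_memberHullInputs_two_NST_of_noSplitTwistSharp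
    (h : Kato2004.exists_memberHullInputs_two_sharp_of_noSplitTwistNegOneNegTwo) :
    Kato2004.exists_memberHullInputs_two_of_noSplitTwistNegOneNegTwo := by
  intro W _ _ hcm hng hnm hnst hred hL hfin
  obtain ⟨W', hE', hM', hiso, hrest⟩ := h W hcm hng hnm hnst hred hL hfin
  refine ⟨W', hE', hM', hiso, ?_⟩
  intro _ _ _ hA N _ f hf ι
  obtain ⟨κ', Λ', c, d, a, A, z, x, hκ', hA0, hc, hd, hbody, hpack⟩ := hrest hA f hf ι
  refine ⟨κ', Λ', c, d, a, A, z, x, hκ', hA0, hc, hd, hbody, ?_⟩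
  intro κ γ hκ hγ I y hy
  obtain ⟨K, -⟩ := hpack κ γ hκ hγ I y hy
  exact ⟨K⟩

/-! ## §1 Kato's member bound at `p = 2` under (NST′), SHARP (exponent `2t`) -/

/-- **Kato's member bound at `p = 2` for REDUCIBLE `E[2]` under (NST′), SHARP** — `katoMemberShaBound_two_sharp` with
`0 ≤ ord₂ j` replaced by (NST′) «no split multiplicative twist by `−1` or `−2` at `2`» (so potentially multiplicative curves
are allowed): granted `hmod`, the (NST′)-sharp member fact (`hin`), `hLim2`, `hFW` BY NAME, Kato's member `W' ∼ W` is globally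
minimal with `Ш(W')` finite and `ord₂ #Ш(W')[2^∞] + v₂ Tam(W') ≤ ord₂(L(W',1)/Ω(W')) + 2·ord₂ #W'(ℚ)_tors`. Statement (A) at
`(W',2)` DISCHARGED (`conjA_two_of_not_irreducible`). Conditional on `hmod`, `hin`, `hLim2`, `hFW`.
[cite: Kato2004Asterisque, Thm. 12.5 (3) and (12.5.1) (p. 222), 13.13 (p. 233), Thm. 12.6 (p. 222), Lemma 13.10 (1) (p. 230), 13.14 (p. 234), §14.14 and Lemma 14.15 (pp. 243–244), Prop. 14.16 (2) and its proof (pp. 244–245), §14.8 (p. 238)]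
[cite: MazurRubin2004, Thm. 2.3.4] [cite: Lim2017FineSelmer, §3 Thm. 3.5] [cite: FerreroWashington1979, Theorem] -/
theorem katoMemberShaBound_two_sharp_NST (hmod : exists_isNewformOf)
    (hin : Kato2004.exists_memberHullInputs_two_sharp_of_noSplitTwistNegOneNegTwo)
    (hLim2 : Lim2017.thm35_at_two_fineSelmerDual_moduleFinite_of_classicalMuVanishes_of_le_divisionField_four)
    (hFW : ferreroWashington1979_classicalMuVanishes)
    (W : WeierstrassCurve ℚ) [W.IsElliptic] [W.IsGloballyMinimal] (hcm : ¬ W.HasCM)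
    (hng : ¬ W.HasGoodReductionAtPrime 2) (hnm : ¬ W.HasMultiplicativeReductionAtPrime 2)
    (hnst : ∀ d : ℚ, d = -1 ∨ d = -2 → ¬ (W.quadraticTwist d).HasSplitMultiplicativeReductionAtPrime 2)
    (hred : ¬ W.HasIrreducibleModPGaloisRep 2)
    (hL : W.entireLFunction 1 ≠ 0) (hfin : Finite W.sha) :
    ∃ (W' : WeierstrassCurve ℚ) (_ : W'.IsElliptic) (_ : W'.IsGloballyMinimal),
      IsIsogenous W W' ∧ Finite W'.sha ∧
      ∃ q : ℚ, W'.entireLFunction 1 / (W'.realPeriodRat : ℂ) = (q : ℂ) ∧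
        (padicValNat 2 (Nat.card (AddCommGroup.primaryComponent W'.sha 2)) : ℤ) +
            padicValNat 2 W'.tamagawaProduct ≤
          padicValRat 2 q + 2 * (padicValNat 2 W'.torsionOrder : ℤ) := by
  -- Kato's member `W'` and the fact's data at it
  obtain ⟨W', hE', hM', hiso, hrest⟩ := hin W hcm hng hnm hnst hred hL hfin
  haveI := hE'
  haveI := hM'
  haveI : ContinuousSMul ℤ_[2] (W'.tateModule 2) := TateModule.continuousSMul_padicInt
  haveI : Module.Free ℤ_[2] (W'.tateModule 2) := W'.module_free_tateModule_holds 2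
  haveI : Module.Finite ℤ_[2] (W'.tateModule 2) := W'.module_finite_tateModule_holds 2
  -- statement (A) at `(W', 2)`: `W'[2]` is reducible with `W[2]`; Lim@2 + Ferrero–Washington BY NAME
  have hred' : ¬ W'.HasIrreducibleModPGaloisRep 2 := not_hasIrreducibleModPGaloisRep_of_isIsogenous hiso hred
  have hA' := conjA_two_of_not_irreducible hLim2 hFW W' hred'
  -- a newform of `W` (modularity) and a family of complex embeddings of the cyclotomic fields
  haveI : NeZero (W.conductorNorm ℤ) := ⟨(W.conductorNorm_pos_holds).ne'⟩
  obtain ⟨f, hf⟩ := hmod W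
  obtain ⟨κ', Λ', c, d, a, A, z, x, -, -, -, -, hbody, hpack⟩ :=
    hrest hA' f hf (fun m => Classical.arbitrary _)
  -- the cyclotomic `ℤ₂`-tower with a topological generator (PROVED), the pinned `𝐇¹_Γ(T₂W')`, the lift `𝐲`
  obtain ⟨κ, hκ, γ, hγ, -⟩ := exists_isCyclotomic_isTopGenerator_isCyclotomicVariable_holds 2
  obtain ⟨I⟩ := nonempty_iwasawaH1Data_holds W' 2 κ γ hκ hγ
  obtain ⟨y, hy⟩ :=
    (IwasawaH1Data.existsUnique_lift_of_zetaBody_two W' hκ I f (fun m => Classical.arbitrary _)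
      κ' Λ' c d a A z x hbody).exists
  -- the package at `(I, 𝐲)` together with the SHARP count
  obtain ⟨K, q, hq, hcount⟩ := hpack κ γ hκ hγ I y hy
  have hfin' : Finite W'.sha := (IsIsogenous.shaFinite_iff_shaFinite hiso).mp hfin
  haveI := K.finite_H
  haveI := K.torsionFree_H
  haveI := K.finite_F
  haveI := K.torsionFree_F
  haveI := K.finite_H2
  -- the divisibility for the hull at EVERY height-one prime: off `(2)` Thm. 12.5 (3), at `(2)` `μ = 0`
  have hdiv : ∀ 𝔮 : PrimeSpectrum (IwasawaAlgebra 2), 𝔮.asIdeal.height = 1 →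
      Module.lengthAt (IwasawaAlgebra 2) K.H2 𝔮 ≤
        Module.lengthAt (IwasawaAlgebra 2) (K.F ⧸ (IwasawaAlgebra 2) ∙ K.z) 𝔮 := by
    intro 𝔮 h𝔮
    by_cases hq' : 𝔮.asIdeal = augIdealP 2
    · have hμ : (Module.lengthAt (IwasawaAlgebra 2) K.H2 𝔮).toNat = 0 := by
        rw [← muInvariant_eq_toNat_lengthAt 2 K.H2 𝔮 hq']; exact K.mu_H2
      have hfinl : Module.lengthAt (IwasawaAlgebra 2) K.H2 𝔮 ≠ ⊤ :=
        IwasawaAlgebra.lengthAt_ne_top_of_isTorsion K.H2 K.isTorsion_H2 𝔮 (le_of_eq h𝔮)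
      have h0' : Module.lengthAt (IwasawaAlgebra 2) K.H2 𝔮 = 0 := by
        rw [← ENat.coe_toNat hfinl, hμ]; rfl
      rw [h0']
      exact bot_le
    · exact K.divisibility_offP 𝔮 h𝔮 hq'
  -- the hull descent with the multiplier (PROVED module theory over `ℤ₂⟦X⟧`)
  have hhull := valuation_add_padicValNat_coinvariants_le_of_hull_smul K.j K.j_injective
    K.finite_coker K.z K.z_ne_zero K.isTorsion_quotient K.isTorsion_H2 hdiv y K.lam
    K.lam_constantCoeff_ne_zero K.j_y K.ι K.π K.ι_injective K.π_surjective K.exact_ι_π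
    K.finite_coinvariants_H2 K.index_ne_zero
  -- the sharp count; the multiplier and the `𝐇²` terms cancel
  refine ⟨W', hE', hM', hiso, hfin', q, hq, ?_⟩
  have hhull' : ((PowerSeries.constantCoeff K.lam).valuation : ℤ) +
      (padicValNat 2 (Nat.card (coinvariants 2 K.H2)) : ℤ) ≤
      (padicValNat 2 (Nat.card (K.A ⧸ (IwasawaAlgebra 2) ∙ K.ι (Submodule.Quotient.mk y))) : ℤ) := by
    exact_mod_cast hhull
  linarith


/-! ## §2 The upper half on every (NST′) reducible additive curve (Cassels transport from the member) -/

/-- **hU3 = `MissingUpperBoundAt W 2` for EVERY globally minimal non-CM `W` ADDITIVE at `2` with NO split multiplicative twist by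
`−1` or `−2`, `W[2]` reducible and `r_an(W) = 0`** (potentially good or potentially multiplicative) — granted `hmod`/`hrat`, the
(NST′)-sharp member fact (`hin`), `hLim2`, `hFW`, Cassels (`hCassels`) and GZK (`hGZK`) BY NAME; NO torsion side condition and NO
parity hypothesis (contrast `missingUpperBoundAt_two_of_katoMember_two_NST`; the Cassels–Tate pairing is not needed). Proof: §1 at
the member, Miller currency (`missingUpperBoundAt_of_sharpKatoCurrency`), Cassels transport
(`TwistComparison.missingUpperBoundAt_of_isIsogenous`). Conditional on the named facts.
[cite: Kato2004Asterisque, Prop. 14.16 (2) and its proof (pp. 244–245), (12.5.1) (p. 222), 13.13 (p. 233)]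
[cite: Cassels1965ArithmeticVIII] [cite: MilneADT2006, Thm. I.7.3] [cite: Miller2011LMS, Def. 1.1] -/
theorem missingUpperBoundAt_two_of_katoMemberSharp_two_NST (hmod : exists_isNewformOf)
    (hin : Kato2004.exists_memberHullInputs_two_sharp_of_noSplitTwistNegOneNegTwo)
    (hLim2 : Lim2017.thm35_at_two_fineSelmerDual_moduleFinite_of_classicalMuVanishes_of_le_divisionField_four)
    (hFW : ferreroWashington1979_classicalMuVanishes)
    (hCassels : bsdRHS_eq_of_isIsogenous)
    (hGZK : rank_eq_analyticRank_of_analyticRank_le_one) (hrat : hasEntireLFunction_rat)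
    (W : WeierstrassCurve ℚ) [W.IsElliptic] [W.IsGloballyMinimal] (hcm : ¬ W.HasCM)
    (hng : ¬ W.HasGoodReductionAtPrime 2) (hnm : ¬ W.HasMultiplicativeReductionAtPrime 2)
    (hnst : ∀ d : ℚ, d = -1 ∨ d = -2 → ¬ (W.quadraticTwist d).HasSplitMultiplicativeReductionAtPrime 2)
    (hred : ¬ W.HasIrreducibleModPGaloisRep 2) (hr : W.analyticRank = 0) :
    MissingUpperBoundAt W 2 := by
  -- `L(W,1) ≠ 0` (modularity) and `Ш(W)` finite (GZK)
  have hL : W.entireLFunction 1 ≠ 0 := (W.analyticRank_eq_zero_iff_holds (hrat W)).mp hr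
  have hr1 : W.analyticRank ≤ 1 := by rw [hr]; exact zero_le_one
  have hfinW : W.ShaFinite := (hGZK W hr1).2
  -- Kato's member `W'` with the sharp count
  obtain ⟨W', hE', hM', hiso, hfin', q, hq, hle⟩ :=
    katoMemberShaBound_two_sharp_NST hmod hin hLim2 hFW W hcm hng hnm hnst hred hL hfinW
  haveI := hE'
  haveI := hM'
  have hr' : W'.analyticRank = 0 := by rw [← analyticRank_eq_of_isIsogenous' hiso, hr]
  have hr1' : W'.analyticRank ≤ 1 := by rw [hr']; exact zero_le_one
  -- the upper half at the member, then Cassels transport `W' ∼ W`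
  have hW' : MissingUpperBoundAt W' 2 :=
    missingUpperBoundAt_of_sharpKatoCurrency hGZK hrat W' 2 hr' hfin' hq hle
  exact TwistComparison.missingUpperBoundAt_of_isIsogenous _ W 2 hCassels hGZK hrat hiso.symm_of_charZero hr1' hW'

/-! ## §3 The block form keyed like the v8 residual's member branch -/

/-- **hU3 on the `E[2]`-REDUCIBLE potentially MULTIPLICATIVE curves satisfying (NST′), with NO side condition** — keyed
`¬CM → r_an = 0 → Addv W 2 → ord₂ j < 0 → (NST′) → ¬ irreducible → MissingUpperBoundAt W 2` (the habitat of the v8 residual's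
member branch, `additiveRankZeroAtTwo_of_residual_v8`, minus its conjunct «small torsion ∧ ord₂ #Ш_an even»); from the
(NST′)-sharp member fact + PRINT BY NAME. No over-`K` object. Conditional; nothing asserted.
[cite: Kato2004Asterisque, Prop. 14.16 (2) (p. 244), (12.5.1) (p. 222), 13.13 (p. 233)] [cite: Cassels1965ArithmeticVIII] -/
theorem addPotMultNST_reducibleUpper_two_sharp (hmod : exists_isNewformOf) (hrat : hasEntireLFunction_rat)
    (hin : Kato2004.exists_memberHullInputs_two_sharp_of_noSplitTwistNegOneNegTwo)
    (hLim2 : Lim2017.thm35_at_two_fineSelmerDual_moduleFinite_of_classicalMuVanishes_of_le_divisionField_four)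
    (hFW : ferreroWashington1979_classicalMuVanishes) (hCassels : bsdRHS_eq_of_isIsogenous)
    (hGZK : rank_eq_analyticRank_of_analyticRank_le_one) :
    ∀ (W : WeierstrassCurve ℚ) [W.IsElliptic] [W.IsGloballyMinimal], ¬ W.HasCM → W.analyticRank = 0 →
      Addv W 2 → padicValRat 2 W.j < 0 →
      (∀ d : ℚ, d = -1 ∨ d = -2 → ¬ (W.quadraticTwist d).HasSplitMultiplicativeReductionAtPrime 2) →
      ¬ W.HasIrreducibleModPGaloisRep 2 → MissingUpperBoundAt W 2 := by
  intro W _ _ hcm hr hadd _ hnst hred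
  exact missingUpperBoundAt_two_of_katoMemberSharp_two_NST hmod hin hLim2 hFW hCassels hGZK hrat W hcm hadd.1 hadd.2
    hnst hred hr

/-- **The whole (NST′) ADDITIVE reducible block at once** (potentially good ∪ potentially multiplicative without a split twist by
`−1`/`−2`), keyed `¬CM → r_an = 0 → Addv W 2 → (NST′) → ¬ irreducible → MissingUpperBoundAt W 2`. Conditional; nothing asserted.
[cite: Kato2004Asterisque, Prop. 14.16 (2) (p. 244), (12.5.1) (p. 222)] [cite: Cassels1965ArithmeticVIII] -/
theorem addNST_reducibleUpper_two_sharp (hmod : exists_isNewformOf) (hrat : hasEntireLFunction_rat)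
    (hin : Kato2004.exists_memberHullInputs_two_sharp_of_noSplitTwistNegOneNegTwo)
    (hLim2 : Lim2017.thm35_at_two_fineSelmerDual_moduleFinite_of_classicalMuVanishes_of_le_divisionField_four)
    (hFW : ferreroWashington1979_classicalMuVanishes) (hCassels : bsdRHS_eq_of_isIsogenous)
    (hGZK : rank_eq_analyticRank_of_analyticRank_le_one) :
    ∀ (W : WeierstrassCurve ℚ) [W.IsElliptic] [W.IsGloballyMinimal], ¬ W.HasCM → W.analyticRank = 0 →
      Addv W 2 → (∀ d : ℚ, d = -1 ∨ d = -2 → ¬ (W.quadraticTwist d).HasSplitMultiplicativeReductionAtPrime 2) →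
      ¬ W.HasIrreducibleModPGaloisRep 2 → MissingUpperBoundAt W 2 := by
  intro W _ _ hcm hr hadd hnst hred
  exact missingUpperBoundAt_two_of_katoMemberSharp_two_NST hmod hin hLim2 hFW hCassels hGZK hrat W hcm hadd.1 hadd.2
    hnst hred hr

end Summit.BirchSwinnertonDyer.BirchSwinnertonDyer.Theorems.AddKatoTwo

end
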